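import Summits.BirchSwinnertonDyer.Rank1Residual.Supersingular.X7VisibilityRecordsC1
import Literature.NumberTheory.EllipticCurves.MazurRubin2015.KummerImageGoodReduction
import HarnessLib

/-!
# N4 / N5 by VISIBILITY — the FIVE-kind shapes: X6 resp. X7 ∧ `r_an = 0` ∧ odd `p` ∧ `ord_p #Ш_an ≤ 2` + a `p`-congruent
# partner with the refined count in which the place `p` itself may be FREE (kind (v), Mazur–Rubin 2015: both curves GOOD at `p`)

Cell `b2b-bsdres`, supersingular family, prover A = unit `b2b-bsdres-x10b` (gen 16), N4 class lead / X7 joint pair A side.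
Topic file; namespace `Summit.BirchSwinnertonDyer.Rank1Residual.Supersingular`.  THEOREMS ONLY (compositions by name); no
named fact, no definition, nothing booked; X6 / X7 stay CONSTRUCTION-SHAPED (marks of RESIDUAL-MAP §I N4 / N5 unchanged).

HONEST FRAMING (run/shared/lean/b2b/bsd-rank1-residual/, verbatim in every file): the goal of the cell is to
DELETE the COMBINATION-SHAPED residual classes of the Birch–Swinnerton-Dyer formula for ALL analytic-rank `≤ 1`
elliptic curves over `ℚ` — "full BSD formula for every rank `≤ 1` curve in class `C`" assembled STRICTLY from
published theorems — so that the rank-`≤ 1` remainder becomes exactly the CONSTRUCTION-SHAPED classes, which are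
TYPED (missing-input `Prop`s), NOT attempted.  This is not "finishing BSD".

## Why (gen 16)

The three-kind (`X7RankZero.bsdp_of_casselsTate_of_congr_of_places_of_surj`, `X7VisibilityRecordsC1.lean`) and four-kind
(`X6RankZero.bsdp_of_casselsTate_of_congr_of_places₄`, `X6VisibilityTamDefectShape.lean`) shapes of gen 15 PAY the place `p`
(`p · #F(ℚ_p)[p]`), because the finite-flat comparison of the Kummer conditions above `p` was not in the tree.  It now is, as the
NAMED FACT `MazurRubin2015.selmerLocalKer_iff_of_goodReduction_above` (Mazur–Rubin, *Selmer companion curves*, TAMS 367 (2015),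
Thm. 3.1 (iv)(b) / §5.3 / §6 Case 5; literature proposal p322361, ACCEPTED) with the proved count
`WeierstrassCurve.exists_sha_ne_zero_of_congr_of_places₅_rat`: kind (v) = `v ∣ p`, both curves GOOD at `v` (over `ℚ`, `e = 1 < p − 1`).
On X6 / X7 the target `E` is good (supersingular) at `p` by definition of the class, so whenever the partner `F` is good at `p` too the
paid set `T` may be EMPTY and the count reads `1 < p ^ rank F`: ONE unit of certified rank suffices for the count (the DB-partner census
of gen 15, kit j156242, marks such pairs `need5 = 1`; the wave-2 scans of gen 16 likewise).  This file states the two compositions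
ONCE so that the per-pair records only decide their data: §1 `X6RankZero.bsdp_of_casselsTate_of_congr_of_places₅` (no image
hypothesis beyond `ClassX6`), §2 `X7RankZero.bsdp_of_casselsTate_of_congr_of_places₅_of_surj` (`surj(p)`, as Wuthrich's constant
is only controlled off exotic images).  Chain (both): `Ш(E)[p] ≠ 0` (`exists_sha_ne_zero_of_congr_of_places₅_rat`; `E(ℚ)` finite of
order prime to `p` by GZK + `ClassX6.irr` / `ClassX7.irr`) ⟹ `p ∣ #Ш` ⟹ `ord_p #Ш_an ≤ ord_p #Ш` by Cassels–Tate squareness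
(`missingLowerBoundAt_of_casselsTate_of_pow_dvd`, x11b) ⟹ `BSD(E,p)` by Wuthrich 2014 Prop. 21 (NO Tamagawa hypothesis).
A remark on parity (not used by the kernel): when ALL places are free (`T = ∅`) the two `p`-Selmer groups coincide inside
`H¹(ℚ, E[p])`, so a partner of Mordell–Weil rank exactly `1` with finite `Ш(F)[p^∞]` cannot occur opposite a rank-`0` target; in
practice the partners have rank `2`, and the gain of kind (v) is that NO local datum at `p` is displayed any more.

References: Mazur–Rubin 2015 Thm. 3.1 [MazurRubin2015SelmerCompanions]; Fisher 2016 Thm. 4.4 [Fisher2016Visualizing7]; Cremona–Mazur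
2000 §3 [CremonaMazur2000]; Wuthrich 2014 Prop. 21 [Wuthrich2014]; Silverman AEC X.4.14 [SilvermanAEC2009]; ATAEC V
[SilvermanATAEC1994]; HOME/b2b-bsdres-x10b/X7-KURIHARA.md (gen 16 section).
-/

set_option autoImplicit false

noncomputable section

open scoped Classical

open WeierstrassCurve Literature.NumberTheory.EllipticCurves
  Literature.NumberTheory.EllipticCurves.Rank1Residual
  Literature.NumberTheory.EllipticCurves.Rank1Residual.Typed
  Literature.NumberTheory.EllipticCurves.Rank1Residual.X11RankOneCertificates
  Literature.NumberTheory.EllipticCurves.Wuthrich2014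
  Literature.NumberTheory.EllipticCurves.Fisher2016
  Literature.NumberTheory.EllipticCurves.MazurRubin2015
  Summit.BirchSwinnertonDyer.BirchSwinnertonDyer.Rank1Residual.IntModel
  Summit.BirchSwinnertonDyer.Rank1Residual.X11b
open NumberField IsDedekindDomain Rat.HeightOneSpectrum

namespace Summit.BirchSwinnertonDyer.Rank1Residual.Supersingular

/-! ### §1. X6 ∧ `r_an = 0`: the five-kind shape -/

/-- **X6 ∩ {r_an = 0}, odd `p`, `ord_p #Ш_an ≤ 2`: `BSD(E,p)` from PUBLISHED theorems plus a `p`-CONGRUENT curve `W'` with the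
FIVE-kind refined visibility count** (pay at `T ⊆ S`, every other place of `S` of one of the five kinds
(i) `w ∤ p`, `W'(ℚ_w)[p] = 0`; (ii) both split multiplicative with `#W(ℚ_w)[p] ≤ p`; (iii) both multiplicative of the same `γ`-class
with `μ_p(ℚ_w) = 1`; (iv) one non-split multiplicative / the other good (Fisher 2016 Thm. 4.4); (v) `w ∣ p`, both GOOD at `w`
(Mazur–Rubin 2015); in particular the place `p` is FREE when `W'` is good at `p`, so `T = ∅` and `1 < p ^ rank W'` is a legal count).  Chain:
`exists_sha_ne_zero_of_congr_of_places₅_rat` (Mazur–Rubin kind (v) `hMR`, Fisher kind (iv) `hF44`, Tate `hU`/`hU2`) with `E(ℚ)`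
finite of order prime to `p` (GZK + `ClassX6.irr`) ⟹ `p ∣ #Ш` ⟹ Cassels–Tate squareness ⟹ Wuthrich Prop. 21
(`X6.bsdp_of_missingLowerBoundAt_of_analyticRank_eq_zero`).  NO Tamagawa hypothesis.  Per pair; NOT a class theorem.
[cite: MazurRubin2015SelmerCompanions, Thm. 3.1 (iv)(b) and §6 Case 5] [cite: Wuthrich2014, Prop. 21 (p. 400)]
[cite: Fisher2016Visualizing7, Thm. 4.4 (p. 106)] [cite: CremonaMazur2000, §3 and Table 1] [cite: SilvermanAEC2009, Thm. X.4.14] -/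
theorem X6RankZero.bsdp_of_casselsTate_of_congr_of_places₅
    (hCT : exists_casselsTate_pairing (K := ℚ)) (hW : sha_dvd_analyticSha)
    (hGZK : rank_eq_analyticRank_of_analyticRank_le_one) (hmod : hasEntireLFunction_rat)
    (hU : Silverman1994_thmV53_tateUniformisation.{0})
    (hU2 : Silverman1994_thmV53_corV54_tateUniformisation.{0})
    (hF44 : thm44_selmerLocalKer_iff_of_nonsplit_good) (hMR : selmerLocalKer_iff_of_goodReduction_above)
    (W : WeierstrassCurve ℚ) [W.IsElliptic] [W.IsGloballyMinimal] (p : ℕ) [Fact p.Prime] (hp : p ≠ 2)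
    (hX : ClassX6 W p) (hr : W.analyticRank = 0) {q : ℚ} (hq : shaAn W = (q : ℂ)) (hv : padicValRat p q ≤ 2)
    (W' : WeierstrassCurve ℚ) [W'.IsElliptic]
    (θ : geomTorsion W' (p : ℤ) ≃+ geomTorsion W (p : ℤ))
    (hθ : ∀ (σ : Field.absoluteGaloisGroup ℚ) (P : geomTorsion W' (p : ℤ)), θ (σ • P) = σ • θ P)
    (S T : Finset (HeightOneSpectrum (𝓞 ℚ))) (hTS : T ⊆ S)
    (hS : ∀ w : HeightOneSpectrum (𝓞 ℚ), w ∉ S →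
      W.HasGoodReductionAt w ∧ W'.HasGoodReductionAt w ∧ (p : 𝓞 ℚ) ∉ w.asIdeal)
    (hT : (∏ w ∈ T, Nat.card (nsmulAddMonoidHom p :
        (W'.baseChange (w.adicCompletion ℚ)).toAffine.Point →+ _).ker *
        Nat.card (w.adicCompletionIntegers ℚ ⧸
          Ideal.span {(p : w.adicCompletionIntegers ℚ)})) < p ^ W'.mordellWeilRank)
    (hplaces : ∀ w ∈ S, w ∉ T →
      ((p : 𝓞 ℚ) ∉ w.asIdeal ∧ Nat.card (nsmulAddMonoidHom p :
          (W'.baseChange (w.adicCompletion ℚ)).toAffine.Point →+ _).ker = 1) ∨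
      (W.HasSplitMultiplicativeReductionAt w ∧ W'.HasSplitMultiplicativeReductionAt w ∧
        Nat.card (nsmulAddMonoidHom p :
          (W.baseChange (w.adicCompletion ℚ)).toAffine.Point →+ _).ker ≤ p) ∨
      (W.HasMultiplicativeReductionAt w ∧ W'.HasMultiplicativeReductionAt w ∧
        (∃ r : w.adicCompletion ℚ, algebraMap ℚ (w.adicCompletion ℚ) (-(W.c₄ / W.c₆)) =
          r ^ 2 * algebraMap ℚ (w.adicCompletion ℚ) (-(W'.c₄ / W'.c₆))) ∧
        (∀ ζ : w.adicCompletion ℚ, ζ ^ p = 1 → ζ = 1)) ∨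
      ((W.HasMultiplicativeReductionAt w ∧ ¬ W.HasSplitMultiplicativeReductionAt w ∧
          W'.HasGoodReductionAt w) ∨
        (W.HasGoodReductionAt w ∧ W'.HasMultiplicativeReductionAt w ∧
          ¬ W'.HasSplitMultiplicativeReductionAt w)) ∨
      ((p : 𝓞 ℚ) ∈ w.asIdeal ∧ W.HasGoodReductionAt w ∧ W'.HasGoodReductionAt w)) :
    BSDp W p := by
  haveI hfin : Finite W.toAffine.Point := finite_point_of_analyticRank_eq_zero W hGZK hr
  have hirr : Irr W p := ClassX6.irr W p hp hX
  have hcop : (Nat.card W.toAffine.Point).Coprime p := coprime_natCard_point_of_irr W p hirr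
  have hex : ∃ c : W.sha, c ≠ 0 ∧ p • c = 0 :=
    W.exists_sha_ne_zero_of_congr_of_places₅_rat hU hU2 hF44 hMR hp W' θ hθ S T hTS hS hfin hcop hT hplaces
  have hfinSha : W.ShaFinite := (hGZK W (by rw [hr]; norm_num)).2
  have hlow : MissingLowerBoundAt W p :=
    missingLowerBoundAt_of_casselsTate_of_pow_dvd W p hCT hfinSha hq (k := 1) (by simpa using hv)
      (by simpa using dvd_shaOrder_of_exists_torsion W p hex)
  exact X6.bsdp_of_missingLowerBoundAt_of_analyticRank_eq_zero W p hW hGZK hmod hp hX hr hlow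

/-! ### §2. X7 ∧ `r_an = 0` ∧ `surj(p)`: the five-kind shape -/

/-- **X7 ∩ {r_an = 0}, odd `p`, SURJECTIVE `ρ̄_{E,p}`, `ord_p #Ш_an ≤ 2`: `BSD(E,p)` from PUBLISHED theorems plus a `p`-CONGRUENT
curve `W'` with the FIVE-kind refined visibility count** (as §1, kinds (i)–(v); the place `p` is FREE when `W'` is good at `p`).  Chain: `exists_sha_ne_zero_of_congr_of_places₅_rat` with `E(ℚ)` finite of order prime to `p` (GZK + `ClassX7.irr`)
⟹ `p ∣ #Ш` ⟹ Cassels–Tate squareness ⟹ Wuthrich Prop. 21 (`X7.bsdp_of_missingLowerBoundAt_of_surj`).  The five-kind twin of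
`X7RankZero.bsdp_of_casselsTate_of_congr_of_places_of_surj` (gen 15).  Per pair; NOT a class theorem.
[cite: MazurRubin2015SelmerCompanions, Thm. 3.1 (iv)(b) and §6 Case 5] [cite: Wuthrich2014, Prop. 21 (p. 400)]
[cite: Fisher2016Visualizing7, Thm. 4.4 (p. 106)] [cite: CremonaMazur2000, §3 and Table 1]
[cite: SilvermanATAEC1994, Ch. V Thm. 3.1, Lemma 5.2, Thm. 5.3, Cor. 5.4] [cite: SilvermanAEC2009, Thm. X.4.14] -/
theorem X7RankZero.bsdp_of_casselsTate_of_congr_of_places₅_of_surj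
    (hCT : exists_casselsTate_pairing (K := ℚ)) (hW : sha_dvd_analyticSha)
    (hGZK : rank_eq_analyticRank_of_analyticRank_le_one) (hmod : hasEntireLFunction_rat)
    (hU : Silverman1994_thmV53_tateUniformisation.{0})
    (hU2 : Silverman1994_thmV53_corV54_tateUniformisation.{0})
    (hF44 : thm44_selmerLocalKer_iff_of_nonsplit_good) (hMR : selmerLocalKer_iff_of_goodReduction_above)
    (W : WeierstrassCurve ℚ) [W.IsElliptic] [W.IsGloballyMinimal] (p : ℕ) [Fact p.Prime] (hp : p ≠ 2)
    (hX : ClassX7 W p) (hs : Surj W p) (hr : W.analyticRank = 0) {q : ℚ} (hq : shaAn W = (q : ℂ))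
    (hv : padicValRat p q ≤ 2)
    (W' : WeierstrassCurve ℚ) [W'.IsElliptic]
    (θ : geomTorsion W' (p : ℤ) ≃+ geomTorsion W (p : ℤ))
    (hθ : ∀ (σ : Field.absoluteGaloisGroup ℚ) (P : geomTorsion W' (p : ℤ)), θ (σ • P) = σ • θ P)
    (S T : Finset (HeightOneSpectrum (𝓞 ℚ))) (hTS : T ⊆ S)
    (hS : ∀ w : HeightOneSpectrum (𝓞 ℚ), w ∉ S →
      W.HasGoodReductionAt w ∧ W'.HasGoodReductionAt w ∧ (p : 𝓞 ℚ) ∉ w.asIdeal)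
    (hT : (∏ w ∈ T, Nat.card (nsmulAddMonoidHom p :
        (W'.baseChange (w.adicCompletion ℚ)).toAffine.Point →+ _).ker *
        Nat.card (w.adicCompletionIntegers ℚ ⧸
          Ideal.span {(p : w.adicCompletionIntegers ℚ)})) < p ^ W'.mordellWeilRank)
    (hplaces : ∀ w ∈ S, w ∉ T →
      ((p : 𝓞 ℚ) ∉ w.asIdeal ∧ Nat.card (nsmulAddMonoidHom p :
          (W'.baseChange (w.adicCompletion ℚ)).toAffine.Point →+ _).ker = 1) ∨
      (W.HasSplitMultiplicativeReductionAt w ∧ W'.HasSplitMultiplicativeReductionAt w ∧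
        Nat.card (nsmulAddMonoidHom p :
          (W.baseChange (w.adicCompletion ℚ)).toAffine.Point →+ _).ker ≤ p) ∨
      (W.HasMultiplicativeReductionAt w ∧ W'.HasMultiplicativeReductionAt w ∧
        (∃ r : w.adicCompletion ℚ, algebraMap ℚ (w.adicCompletion ℚ) (-(W.c₄ / W.c₆)) =
          r ^ 2 * algebraMap ℚ (w.adicCompletion ℚ) (-(W'.c₄ / W'.c₆))) ∧
        (∀ ζ : w.adicCompletion ℚ, ζ ^ p = 1 → ζ = 1)) ∨
      ((W.HasMultiplicativeReductionAt w ∧ ¬ W.HasSplitMultiplicativeReductionAt w ∧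
          W'.HasGoodReductionAt w) ∨
        (W.HasGoodReductionAt w ∧ W'.HasMultiplicativeReductionAt w ∧
          ¬ W'.HasSplitMultiplicativeReductionAt w)) ∨
      ((p : 𝓞 ℚ) ∈ w.asIdeal ∧ W.HasGoodReductionAt w ∧ W'.HasGoodReductionAt w)) :
    BSDp W p := by
  haveI hfin : Finite W.toAffine.Point := finite_point_of_analyticRank_eq_zero W hGZK hr
  have hirr : Irr W p := ClassX7.irr W p hp hX
  have hcop : (Nat.card W.toAffine.Point).Coprime p := coprime_natCard_point_of_irr W p hirr
  have hex : ∃ c : W.sha, c ≠ 0 ∧ p • c = 0 :=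
    W.exists_sha_ne_zero_of_congr_of_places₅_rat hU hU2 hF44 hMR hp W' θ hθ S T hTS hS hfin hcop hT hplaces
  have hfinSha : W.ShaFinite := (hGZK W (by rw [hr]; norm_num)).2
  have hlow : MissingLowerBoundAt W p :=
    missingLowerBoundAt_of_casselsTate_of_pow_dvd W p hCT hfinSha hq (k := 1) (by simpa using hv)
      (by simpa using dvd_shaOrder_of_exists_torsion W p hex)
  exact X7.bsdp_of_missingLowerBoundAt_of_surj W p hW hGZK hmod hp hX hs hr hlow

/-! ### §3. The empty paid set: with kind (v) at `p` the count is `1 < p ^ rank W'`, i.e. ONE unit of certified rank -/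

/-- With `T = ∅` the refined count `∏_{w ∈ T} (…) < p ^ rank W'` reads `1 < p ^ rank W'` and holds as soon as
`1 ≤ rank W'`. [folklore] -/
theorem prod_empty_lt_pow_of_one_le_rank {p r : ℕ} (hp : 2 ≤ p) (hr : 1 ≤ r) (f : HeightOneSpectrum (𝓞 ℚ) → ℕ) :
    (∏ w ∈ (∅ : Finset (HeightOneSpectrum (𝓞 ℚ))), f w) < p ^ r := by
  rw [Finset.prod_empty]
  calc (1 : ℕ) < p ^ 1 := by rw [pow_one]; omega
    _ ≤ p ^ r := Nat.pow_le_pow_right (by omega) hr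

/-! ### §4. Place helper for kind (ii): SPLIT multiplicative reduction at the place `w` over `ℓ` read off the integer model
(appended, x10b gen 16: a ROOT of the node-tangent quadratic mod `ℓ`, the positive twin of
`not_hasSplitMultiplicativeReductionAt_of_intModel_of_noroot`) -/

/-- SPLIT multiplicative reduction at the place `w` over `ℓ` from the integer model: `ℓ ∣ Δ(E₀)`, `ℓ ∤ c₄(E₀)` and an explicit
root `t` of the node-tangent quadratic of `E₀` mod `ℓ` (the tree's `hasSplitMultiplicativeReductionAtPrime_of_intModel_of_root`,
moved to the place). [cite: SilvermanAEC2009, VII.5 Prop. 5.1(b)] -/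
theorem hasSplitMultiplicativeReductionAt_of_intModel_of_root {W : WeierstrassCurve ℚ} [W.IsElliptic]
    [W.IsGloballyMinimal] {E₀ : WeierstrassCurve ℤ} (hI : integralModelInt W = E₀)
    (w : HeightOneSpectrum (𝓞 ℚ)) {ℓ : ℕ} [hℓ : Fact ℓ.Prime] (hw : (primesEquiv w : ℕ) = ℓ)
    (hΔ : (ℓ : ℤ) ∣ E₀.Δ) (hc₄ : ¬ (ℓ : ℤ) ∣ E₀.c₄) (t : ZMod ℓ)
    (ht : (E₀.c₄ : ZMod ℓ) * t ^ 2 + (E₀.a₁ * E₀.c₄ : ZMod ℓ) * t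
      - (54 * E₀.b₆ - 3 * E₀.b₂ * E₀.b₄ + E₀.a₂ * E₀.c₄ : ZMod ℓ) = 0) :
    W.HasSplitMultiplicativeReductionAt w := by
  have h1 := hasSplitMultiplicativeReductionAtPrime_of_intModel_of_root hI ℓ hΔ hc₄ ⟨t, ht⟩
  have key : ∀ q : Nat.Primes, primesEquiv w = q →
      ((haveI := Fact.mk q.2; W.HasSplitMultiplicativeReductionAtPrime (q : ℕ)) ↔
        W.HasSplitMultiplicativeReductionAt w) := by
    rintro q rfl
    exact hasSplitMultiplicativeReductionAtPrime_iff_hasSplitMultiplicativeReductionAt W w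
  have hq : primesEquiv w = ⟨ℓ, hℓ.out⟩ := Subtype.ext hw
  rw [← key _ hq]
  exact h1

end Summit.BirchSwinnertonDyer.Rank1Residual.Supersingular

end
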